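import Summits.CriticalPhenomena.PercolationContinuityZ3.Theorems.Transplant.FKConnectivityAllQCountReweightedClusterDomDefs
import Summits.CriticalPhenomena.PercolationContinuityZ3.Theorems.Transplant.FKConnectivityAllQArborealContraction
import Summits.CriticalPhenomena.PercolationContinuityZ3.Theorems.PercNearOneGluingNoHeavyLowerTailFKCSHPhiMonotoneCluster
import Literature.Probability.Percolation.KozmaNitzanClusterProperty
import HarnessLib

/-!
# MM ⇒ CA ⇒ hub for cluster-COUNT-reweighted percolation `μ_{w,h} ∝ P_w·h(k)` (every positive `h`): Harris' induction on the pairs at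
# the weight-1 cluster, transplanted from `φ_{w,q}` (fk-1 g8) to count weights

Support file (`--supports stmt-CriticalPhenomena-4575`), FK sub-lane `prim-bschramm-fk-1` (gen 10) of the post-continuity programme;
builds on p205010 (kernel theorem, internal audit signed; external expert review pending).  No new definitions of statements, no named
facts, no sorries; standard axioms.

For every positive `h : ℕ → ℝ` and the measures `μ_{w,h} = crMeasure w h`:
* tools — one-point decomposition `cr_real_opd` (`μ_w(D) = λ·μ_{w[f↦1]}(D) + (1−λ)·μ_{w[f↦0]}(D)`, `λ = μ_w(f open)`), support lemma
  `mem_of_crWeight_ne_zero`, transport of cluster events along weight-1 paths, deterministic clusters;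
* **`clusterAssocCount_of_clusterDomAdjCount`** — MM under `h` (`ClusterDomAdjCountOn V h`: law of `C_x` given an adjacent pair open
  dominates the law given it closed) ⇒ the law of `C_x` is POSITIVELY ASSOCIATED: `μ(C_x ∈ 𝒰)μ(C_x ∈ 𝒱) ≤ μ(C_x ∈ 𝒰 ∩ 𝒱)` for up-sets;
* **`hubUnder_crMeasure_of_clusterDomAdjCount`** — hence the hub inequality `μ(o↔a)μ(b↔a) ≤ μ(o↔a↔b)`;
* corollaries: `clusterAssocCount_of_monotone` (CA for every non-decreasing log-convex `h`, via fk-1 g10's `clusterDomAdjCountOn_of_monotone`)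
  and the node-level `hub_of_clusterDomAdjLogConvexPos` (the census-backed node `ClusterDomAdjLogConvexPos` ⇒ the hub inequality for every
  log-convex count weight on every finite weighted graph — the count-weight column of ALR's (15)).
So the count-weight column has the same shape as the `q < 1` column (fk-1 g7/g8) and the arboreal column (fk-1 g9): one master node
(MM for log-convex `h`), kernel implications to CA and the hub inequality, the monotone case a theorem, the log-concave case refuted
(`…CountReweightedCex`).
[cite: Grimmett2006, Thm. (2.19) proof (pp. 26–27); Thm. (3.7) (p. 39); §3.9 (pp. 63–65); §1.4 eq. (1.20) (p. 15)]
[cite: AyyerLinussonRavichandran2025, §7 eq. (13)–(15), Conj. 7.1 (p. 22)]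
-/

noncomputable section

namespace Summit.CriticalPhenomena.PercolationContinuityZ3.Theorems

namespace FK

open MeasureTheory Set Literature.Probability.LatticeModels Literature.Probability.Percolation
open Literature.Probability.Percolation.TwoAvoidanceSets (ind_mul_ind)
open scoped Classical
open BHK2006 DecisionTree HullPort

variable {V : Type*} [Fintype V] (w : Sym2 V → unitInterval) {h : ℕ → ℝ}

/-! ### Weight sums, revealed pairs, one-point decomposition -/

/-- Present branch: `crWeight_w(ω)·1{f ∈ ω} = w_f·crWeight_{w[f↦1]}(ω)`. [cite: Grimmett2006, Thm. (3.7) (p. 39)] -/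
theorem crWeight_mul_ind_mem (h : ℕ → ℝ) (f : Sym2 V) (ω : BondConfig V) :
    crWeight w h ω * ind {ω : BondConfig V | f ∈ ω} ω = (w f : ℝ) * crWeight (setW w f true) h ω := by
  unfold crWeight
  by_cases hf : f ∈ ω
  · rw [ind_of_mem (show ω ∈ {ω : BondConfig V | f ∈ ω} from hf), mul_one, weight_eq_factor_mul _ f,
      weight_eq_factor_mul (fun e => ((setW w f true e : unitInterval) : ℝ)) f, if_pos hf, if_pos hf, prod_erase_setW w f true ω,
      coe_setW_self]
    simp only [ite_true]; ring
  · rw [ind_of_not_mem (show ω ∉ {ω : BondConfig V | f ∈ ω} from hf), mul_zero,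
      weight_eq_factor_mul (fun e => ((setW w f true e : unitInterval) : ℝ)) f, if_neg hf, coe_setW_self]
    simp

/-- Absent branch: `crWeight_w(ω)·1{f ∉ ω} = (1 − w_f)·crWeight_{w[f↦0]}(ω)`. [cite: Grimmett2006, Thm. (3.7) (p. 39)] -/
theorem crWeight_mul_ind_not_mem (h : ℕ → ℝ) (f : Sym2 V) (ω : BondConfig V) :
    crWeight w h ω * ind {ω : BondConfig V | f ∉ ω} ω = (1 - (w f : ℝ)) * crWeight (setW w f false) h ω := by
  unfold crWeight
  by_cases hf : f ∈ ω
  · rw [ind_of_not_mem (show ω ∉ {ω : BondConfig V | f ∉ ω} from fun hn => hn hf), mul_zero,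
      weight_eq_factor_mul (fun e => ((setW w f false e : unitInterval) : ℝ)) f, if_pos hf, coe_setW_self]
    simp
  · rw [ind_of_mem (show ω ∈ {ω : BondConfig V | f ∉ ω} from hf), mul_one, weight_eq_factor_mul _ f,
      weight_eq_factor_mul (fun e => ((setW w f false e : unitInterval) : ℝ)) f, if_neg hf, if_neg hf, prod_erase_setW w f false ω,
      coe_setW_self]
    norm_num
    ring

/-- **Affine decomposition**: `crWeight_{w[f↦c]}(ω) = c·crWeight_{w[f↦1]}(ω) + (1−c)·crWeight_{w[f↦0]}(ω)`. [cite: Grimmett2006, Thm. (3.7) (p. 39)] -/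
theorem crWeight_update_eq (h : ℕ → ℝ) (f : Sym2 V) (c : unitInterval) (ω : BondConfig V) :
    crWeight (Function.update w f c) h ω =
      (c : ℝ) * crWeight (setW w f true) h ω + (1 - (c : ℝ)) * crWeight (setW w f false) h ω := by
  have h1 := crWeight_mul_ind_mem (Function.update w f c) h f ω
  have h0 := crWeight_mul_ind_not_mem (Function.update w f c) h f ω
  rw [setW_update, Function.update_self] at h1 h0
  have hsplit : crWeight (Function.update w f c) h ω =
      crWeight (Function.update w f c) h ω * ind {ω : BondConfig V | f ∈ ω} ω +
        crWeight (Function.update w f c) h ω * ind {ω : BondConfig V | f ∉ ω} ω := by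
    by_cases hf : f ∈ ω
    · rw [ind_of_mem (show ω ∈ {ω : BondConfig V | f ∈ ω} from hf),
        ind_of_not_mem (show ω ∉ {ω : BondConfig V | f ∉ ω} from fun hn => hn hf)]; ring
    · rw [ind_of_not_mem (show ω ∉ {ω : BondConfig V | f ∈ ω} from hf),
        ind_of_mem (show ω ∈ {ω : BondConfig V | f ∉ ω} from hf)]; ring
  rw [hsplit, h1, h0]

/-- **One-point decomposition of `μ_{w,h}`** (`h > 0`): there is `λ ∈ [0,1]` (namely `μ_w(f open)`) with
`μ_w(D) = λ·μ_{w[f↦1]}(D) + (1−λ)·μ_{w[f↦0]}(D)` for every event `D`. [cite: Grimmett2006, Thm. (3.7) (p. 39)] -/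
theorem cr_real_opd (hpos : ∀ k, 0 < h k) (f : Sym2 V) :
    ∃ l : ℝ, 0 ≤ l ∧ l ≤ 1 ∧ ∀ D : Set (BondConfig V), (crMeasure w h).real D =
      l * (crMeasure (setW w f true) h).real D + (1 - l) * (crMeasure (setW w f false) h).real D := by
  have hw : Function.update w f (w f) = w := Function.update_eq_self f w
  have hc0 : 0 ≤ ((w f : unitInterval) : ℝ) := (w f).2.1
  have hc1 : ((w f : unitInterval) : ℝ) ≤ 1 := (w f).2.2
  have hZ1 := crPartition_pos (setW w f true) hpos
  have hZ0 := crPartition_pos (setW w f false) hpos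
  have hZ : crPartition w h = (w f : ℝ) * crPartition (setW w f true) h + (1 - (w f : ℝ)) * crPartition (setW w f false) h := by
    unfold crPartition
    rw [Finset.mul_sum, Finset.mul_sum, ← Finset.sum_add_distrib]
    refine Finset.sum_congr rfl fun ω _ => ?_
    have e := crWeight_update_eq w h f (w f) ω
    rw [hw] at e
    exact e
  have hZpos : 0 < (w f : ℝ) * crPartition (setW w f true) h + (1 - (w f : ℝ)) * crPartition (setW w f false) h := by
    rcases hc1.eq_or_lt with h1 | h1
    · rw [h1]; simpa using hZ1
    · nlinarith
  refine ⟨(w f : ℝ) * crPartition (setW w f true) h / ((w f : ℝ) * crPartition (setW w f true) h +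
      (1 - (w f : ℝ)) * crPartition (setW w f false) h), div_nonneg (mul_nonneg hc0 hZ1.le) hZpos.le,
    (div_le_one hZpos).2 (by nlinarith), fun D => ?_⟩
  have hS : ∑ ω : BondConfig V, crWeight w h ω * ind D ω =
      (w f : ℝ) * ∑ ω : BondConfig V, crWeight (setW w f true) h ω * ind D ω +
        (1 - (w f : ℝ)) * ∑ ω : BondConfig V, crWeight (setW w f false) h ω * ind D ω := by
    rw [Finset.mul_sum, Finset.mul_sum, ← Finset.sum_add_distrib]
    refine Finset.sum_congr rfl fun ω _ => ?_
    have e := crWeight_update_eq w h f (w f) ω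
    rw [hw] at e
    rw [e]; ring
  rw [crMeasure_real_eq_sum_div w hpos D, crMeasure_real_eq_sum_div _ hpos D, crMeasure_real_eq_sum_div _ hpos D, hZ, hS]
  have hZ1' := hZ1.ne'
  have hZ0' := hZ0.ne'
  have hZp' := hZpos.ne'
  field_simp
  ring

/-! ### Support, transport along weight-1 paths, deterministic clusters -/

/-- **Support lemma**: if `crWeight_w(ω) ≠ 0` then parameter-`1` pairs are open and parameter-`0` pairs closed in `ω`. [folklore] -/
theorem mem_of_crWeight_ne_zero (h : ℕ → ℝ) {ω : BondConfig V} (hω : crWeight w h ω ≠ 0) :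
    (∀ f, w f = 1 → f ∈ ω) ∧ (∀ f, w f = 0 → f ∉ ω) := by
  have key : ∀ f, ((f ∉ ω ∧ w f = 1) ∨ (f ∈ ω ∧ w f = 0)) → crWeight w h ω = 0 := by
    intro f hf
    have hzero : weight (fun e => ((w e : unitInterval) : ℝ)) ω = 0 := by
      rw [weight_eq_factor_mul _ f]
      rcases hf with ⟨hfω, h1⟩ | ⟨hfω, h0⟩
      · rw [if_neg hfω]; simp [h1]
      · rw [if_pos hfω]; simp [h0]
    unfold crWeight; rw [hzero, zero_mul]
  refine ⟨fun f hf => ?_, fun f hf hfω => hω (key f (Or.inr ⟨hfω, hf⟩))⟩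
  by_contra hfω
  exact hω (key f (Or.inl ⟨hfω, hf⟩))

/-- Sums against `crWeight` only see the support. [folklore] -/
theorem sum_crWeight_congr_support (h : ℕ → ℝ) {g g' : BondConfig V → ℝ} (H : ∀ ω, crWeight w h ω ≠ 0 → g ω = g' ω) :
    ∑ ω : BondConfig V, crWeight w h ω * g ω = ∑ ω : BondConfig V, crWeight w h ω * g' ω := by
  refine Finset.sum_congr rfl fun ω _ => ?_
  by_cases hω : crWeight w h ω = 0
  · rw [hω, zero_mul, zero_mul]
  · rw [H ω hω]

/-- On the support, the cluster of `x` equals the cluster of every vertex `v` joined to `x` by parameter-1 pairs. [folklore] -/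
theorem cr_ind_clusterIn_eq_of_oneSet_reachable (h : ℕ → ℝ) {x v : V} (hxv : (openGraph (oneSet w)).Reachable x v) (𝒰 : Set (Set V))
    {ω : BondConfig V} (hω : crWeight w h ω ≠ 0) : ind (clusterIn x 𝒰) ω = ind (clusterIn v 𝒰) ω := by
  have hsub : oneSet w ⊆ ω := fun f hf => (mem_of_crWeight_ne_zero w h hω).1 f hf
  have hR : (openGraph ω).Reachable x v := hxv.mono (openGraph_le hsub)
  have hC := KNPreFKG.openCluster_eq_of_reachable hR
  by_cases hm : ω ∈ clusterIn x 𝒰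
  · have hm' : ω ∈ clusterIn v 𝒰 := by change openCluster ω v ∈ 𝒰; rw [← hC]; exact hm
    rw [ind_of_mem hm, ind_of_mem hm']
  · have hm' : ω ∉ clusterIn v 𝒰 := by intro h'; apply hm; change openCluster ω x ∈ 𝒰; rw [hC]; exact h'
    rw [ind_of_not_mem hm, ind_of_not_mem hm']

/-- Hence `μ(C_x ∈ 𝒰, C_x ∈ 𝒱) = μ(C_v ∈ 𝒰, C_v ∈ 𝒱)` for `v` surely joined to `x`. [folklore] -/
theorem cr_real_clusterIn_inter_eq_of_oneSet_reachable (hpos : ∀ k, 0 < h k) {x v : V} (hxv : (openGraph (oneSet w)).Reachable x v)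
    (𝒰 𝒱 : Set (Set V)) :
    (crMeasure w h).real (clusterIn x 𝒰 ∩ clusterIn x 𝒱) = (crMeasure w h).real (clusterIn v 𝒰 ∩ clusterIn v 𝒱) := by
  rw [crMeasure_real_eq_sum_div w hpos, crMeasure_real_eq_sum_div w hpos]
  congr 1
  refine sum_crWeight_congr_support w h fun ω hω => ?_
  rw [← ind_mul_ind, ← ind_mul_ind, cr_ind_clusterIn_eq_of_oneSet_reachable w h hxv 𝒰 hω,
    cr_ind_clusterIn_eq_of_oneSet_reachable w h hxv 𝒱 hω]

/-- Single-event version. [folklore] -/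
theorem cr_real_clusterIn_eq_of_oneSet_reachable (hpos : ∀ k, 0 < h k) {x v : V} (hxv : (openGraph (oneSet w)).Reachable x v)
    (𝒰 : Set (Set V)) : (crMeasure w h).real (clusterIn x 𝒰) = (crMeasure w h).real (clusterIn v 𝒰) := by
  have e := cr_real_clusterIn_inter_eq_of_oneSet_reachable w hpos hxv 𝒰 𝒰
  rwa [inter_self, inter_self] at e

/-- On the support, if every pair meeting the weight-1 cluster of `x` is determined, the open cluster of `x` IS that weight-1 cluster.
[folklore] -/
theorem cr_openCluster_eq_of_determined (h : ℕ → ℝ) (x : V) (hA : ∀ f ∈ cut {x} (oneSet w), w f = 0 ∨ w f = 1)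
    {ω : BondConfig V} (hω : crWeight w h ω ≠ 0) : openCluster ω x = openCluster (oneSet w) x := by
  obtain ⟨h1, h0⟩ := mem_of_crWeight_ne_zero w h hω
  have hsub : oneSet w ⊆ ω := fun f hf => h1 f hf
  ext z
  change (openGraph ω).Reachable x z ↔ (openGraph (oneSet w)).Reachable x z
  constructor
  · intro hxz
    rw [SimpleGraph.reachable_iff_reflTransGen] at hxz
    induction hxz with
    | refl => exact SimpleGraph.Reachable.refl x
    | @tail a b _ hab ih =>
      rw [openGraph_adj] at hab
      have hcut : s(a, b) ∈ cut {x} (oneSet w) := ⟨a, Sym2.mem_mk_left a b, x, rfl, ih⟩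
      rcases hA _ hcut with hz | hz
      · exact absurd hab.1 (h0 _ hz)
      · have hadj : (openGraph (oneSet w)).Adj a b := by rw [openGraph_adj]; exact ⟨hz, hab.2⟩
        exact ih.trans hadj.reachable
  · exact fun hxz => hxz.mono (openGraph_le hsub)

/-- **Deterministic cluster**: under that hypothesis `μ(C_x ∈ 𝒰) = 1[A ∈ 𝒰]` (`h > 0`, `A` the weight-1 cluster of `x`). [folklore] -/
theorem cr_real_clusterIn_of_determined (hpos : ∀ k, 0 < h k) (x : V) (hA : ∀ f ∈ cut {x} (oneSet w), w f = 0 ∨ w f = 1)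
    (𝒰 : Set (Set V)) : (crMeasure w h).real (clusterIn x 𝒰) = ind 𝒰 (openCluster (oneSet w) x) := by
  have hZ := crPartition_pos w hpos
  rw [crMeasure_real_eq_sum_div w hpos]
  have hc : ∑ ω : BondConfig V, crWeight w h ω * ind (clusterIn x 𝒰) ω =
      ∑ ω : BondConfig V, crWeight w h ω * ind 𝒰 (openCluster (oneSet w) x) := by
    refine sum_crWeight_congr_support w h fun ω hω => ?_
    have hC := cr_openCluster_eq_of_determined w h x hA hω
    by_cases hm : ω ∈ clusterIn x 𝒰
    · rw [ind_of_mem hm]; have : openCluster (oneSet w) x ∈ 𝒰 := by rw [← hC]; exact hm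
      rw [ind_of_mem this]
    · rw [ind_of_not_mem hm]; have : openCluster (oneSet w) x ∉ 𝒰 := by rw [← hC]; exact hm
      rw [ind_of_not_mem this]
  rw [hc, ← Finset.sum_mul]
  change crPartition w h * _ / crPartition w h = _
  field_simp

/-! ### MM ⇒ CA ⇒ hub -/

/-- **MM ⇒ CA under the count weight `h`, inductive form** (induction on the number of undetermined pairs; reveal an undetermined pair
at the weight-1 cluster of `x`; Harris' step `assoc_step` with MM transported to the surely-joined vertex).
[cite: Grimmett2006, Thm. (2.19) proof (pp. 26–27); Thm. (3.7) (p. 39)] -/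
theorem clusterAssocCount_aux (hpos : ∀ k, 0 < h k) (hMM : ClusterDomAdjCountOn V h) :
    ∀ (n : ℕ) (w : Sym2 V → unitInterval), (undet w).card = n → ∀ (x : V) (𝒰 𝒱 : Set (Set V)), IsUpperSet 𝒰 → IsUpperSet 𝒱 →
      (crMeasure w h).real (clusterIn x 𝒰) * (crMeasure w h).real (clusterIn x 𝒱) ≤ (crMeasure w h).real (clusterIn x 𝒰 ∩ clusterIn x 𝒱) := by
  intro n
  induction n using Nat.strong_induction_on with
  | _ n ih =>
    intro w hn x 𝒰 𝒱 h𝒰 h𝒱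
    by_cases hcase : ∃ f ∈ cut {x} (oneSet w), f ∈ undet w
    · obtain ⟨f, ⟨v, hvf, x', hx', hxv⟩, hfu⟩ := hcase
      rw [mem_singleton_iff] at hx'
      subst hx'
      have hf : f = s(v, Sym2.Mem.other hvf) := (Sym2.other_spec hvf).symm
      set b := Sym2.Mem.other hvf with hb
      have hw1 : w f ≠ 1 := fun h1 => (mem_undet_iff w f).1 hfu (Or.inr h1)
      have reach : ∀ bb : Bool, (openGraph (oneSet (setW w f bb))).Reachable x' v := fun bb =>
        hxv.mono (openGraph_le (oneSet_subset_oneSet_setW w hw1 bb))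
      obtain ⟨l, hl0, hl1, hopd⟩ := cr_real_opd w hpos f
      have eA := hopd (clusterIn x' 𝒰)
      have eB := hopd (clusterIn x' 𝒱)
      have eAB := hopd (clusterIn x' 𝒰 ∩ clusterIn x' 𝒱)
      have hlt : ∀ bb : Bool, (undet (setW w f bb)).card < n := fun bb => by
        have h1 := card_undet_setW_le w hfu bb
        have hp : 0 < (undet w).card := Finset.card_pos.2 ⟨f, hfu⟩
        omega
      have ih1 := ih _ (hlt true) (setW w f true) rfl x' 𝒰 𝒱 h𝒰 h𝒱
      have ih0 := ih _ (hlt false) (setW w f false) rfl x' 𝒰 𝒱 h𝒰 h𝒱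
      have mmA : (crMeasure (setW w f false) h).real (clusterIn x' 𝒰) ≤ (crMeasure (setW w f true) h).real (clusterIn x' 𝒰) := by
        rw [cr_real_clusterIn_eq_of_oneSet_reachable _ hpos (reach false) 𝒰, cr_real_clusterIn_eq_of_oneSet_reachable _ hpos (reach true) 𝒰,
          setW_false_eq, setW_true_eq, hf]
        exact hMM w v b 𝒰 h𝒰
      have mmB : (crMeasure (setW w f false) h).real (clusterIn x' 𝒱) ≤ (crMeasure (setW w f true) h).real (clusterIn x' 𝒱) := by
        rw [cr_real_clusterIn_eq_of_oneSet_reachable _ hpos (reach false) 𝒱, cr_real_clusterIn_eq_of_oneSet_reachable _ hpos (reach true) 𝒱,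
          setW_false_eq, setW_true_eq, hf]
        exact hMM w v b 𝒱 h𝒱
      rw [eA, eB, eAB]
      exact assoc_step hl0 hl1 ih1 ih0 mmA mmB
    · push Not at hcase
      have hA : ∀ f ∈ cut {x} (oneSet w), w f = 0 ∨ w f = 1 := fun f hf => by
        have := hcase f hf; rw [mem_undet_iff] at this; push Not at this; exact this
      have hinter : clusterIn x 𝒰 ∩ clusterIn x 𝒱 = clusterIn x (𝒰 ∩ 𝒱) := by ext ω; simp [clusterIn]
      rw [hinter, cr_real_clusterIn_of_determined w hpos x hA 𝒰, cr_real_clusterIn_of_determined w hpos x hA 𝒱,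
        cr_real_clusterIn_of_determined w hpos x hA (𝒰 ∩ 𝒱), ind_inter]

/-- **MM ⇒ CA for count weights**: for every positive `h`, `ClusterDomAdjCountOn V h` implies that the law of the cluster of every vertex
under every `μ_{w,h}` is positively associated. [cite: Grimmett2006, Thm. (2.19) (pp. 26–27); §3.9 (pp. 63–65)] -/
theorem clusterAssocCount_of_clusterDomAdjCount (hpos : ∀ k, 0 < h k) (hMM : ClusterDomAdjCountOn V h) (w : Sym2 V → unitInterval)
    (x : V) {𝒰 𝒱 : Set (Set V)} (h𝒰 : IsUpperSet 𝒰) (h𝒱 : IsUpperSet 𝒱) :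
    (crMeasure w h).real (clusterIn x 𝒰) * (crMeasure w h).real (clusterIn x 𝒱) ≤ (crMeasure w h).real (clusterIn x 𝒰 ∩ clusterIn x 𝒱) :=
  clusterAssocCount_aux hpos hMM _ w rfl x 𝒰 𝒱 h𝒰 h𝒱

/-- **MM ⇒ the hub inequality for count weights**: `μ(o ↔ a)·μ(b ↔ a) ≤ μ(o ↔ a ↔ b)` under `ClusterDomAdjCountOn V h`, `h > 0`.
[cite: AyyerLinussonRavichandran2025, §7 eq. (13)–(15) (p. 22)] -/
theorem hubUnder_crMeasure_of_clusterDomAdjCount (hpos : ∀ k, 0 < h k) (hMM : ClusterDomAdjCountOn V h) (w : Sym2 V → unitInterval)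
    (o a b : V) : HubUnder (crMeasure w h) o a b := by
  unfold HubUnder
  haveI := isProbabilityMeasure_crMeasure w hpos
  rw [probReal_univ, one_mul, KNPreFKG.openConn_symm o a, KNPreFKG.openConn_symm b a, ← clusterIn_mem_eq_openConn a o,
    ← clusterIn_mem_eq_openConn a b]
  exact clusterAssocCount_of_clusterDomAdjCount hpos hMM w a (SoloBlindKN.isUpperSet_containing o) (SoloBlindKN.isUpperSet_containing b)

/-- **CA for every non-decreasing log-convex count weight** (through MM, which is a theorem there: `clusterDomAdjCountOn_of_monotone`).
[cite: Grimmett2006, Thm. (2.19), Thm. (3.8) (pp. 26–27, 39)] -/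
theorem clusterAssocCount_of_monotone (hpos : ∀ k, 0 < h k) (hmono : Monotone h) (hlc : ∀ j, h (j + 1) * h (j + 1) ≤ h j * h (j + 2))
    (w : Sym2 V → unitInterval) (x : V) {𝒰 𝒱 : Set (Set V)} (h𝒰 : IsUpperSet 𝒰) (h𝒱 : IsUpperSet 𝒱) :
    (crMeasure w h).real (clusterIn x 𝒰) * (crMeasure w h).real (clusterIn x 𝒱) ≤ (crMeasure w h).real (clusterIn x 𝒰 ∩ clusterIn x 𝒱) :=
  clusterAssocCount_of_clusterDomAdjCount hpos (clusterDomAdjCountOn_of_monotone hpos hmono hlc) w x h𝒰 h𝒱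

/-- **Node level: `ClusterDomAdjLogConvexPos` ⇒ the hub inequality for every positive log-convex count weight on every finite weighted
graph** (monotone or not; e.g. `2^k + 2^{6−k}`, `(1/2)^k`). [cite: AyyerLinussonRavichandran2025, §7 eq. (15) (p. 22)] -/
theorem hub_of_clusterDomAdjLogConvexPos (hc : ClusterDomAdjLogConvexPos) (n : ℕ) {h : ℕ → ℝ} (hpos : ∀ k, 0 < h k)
    (hlc : ∀ j, h (j + 1) * h (j + 1) ≤ h j * h (j + 2)) (w : Sym2 (Fin n) → unitInterval) (o a b : Fin n) :
    HubUnder (crMeasure w h) o a b :=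
  hubUnder_crMeasure_of_clusterDomAdjCount hpos (hc n h hpos hlc) w o a b

end FK

end Summit.CriticalPhenomena.PercolationContinuityZ3.Theorems

end
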